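import Literature.Combinatorics.LorentzianPolynomials.MathlibMatroid
import Literature.Combinatorics.LorentzianPolynomials.StableQuadratic
import HarnessLib

/-!
# The support of a multi-affine Lorentzian polynomial is the set of bases of a matroid; Choe–Oxley–Sokal–Wagner for
# stable quadratic forms (Brändén–Huh 2020, §3.2 Thm. 3.10 (1) ⟹ (8); §2.4, after Thm. 2.23)

Layer `Literature/Combinatorics/LorentzianPolynomials`, namespace `Literature.Combinatorics.LorentzianPolynomials`;
lane `lit-hodgefound` (Track 2 foundations library), seat p16, generation 27 (row g27-#19). Joins three files of the
lane: `MathlibMatroid.lean` (Thm. 3.10 (1) ⟺ (8) for a GIVEN exponent set `J ⊆ {0,1}^σ`, with Mathlib's `Matroid σ`),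
`StableQuadratic.lean` (a stable quadratic form with nonnegative coefficients is Lorentzian) and the tree's
stable-polynomial library (`IsRealStable`, `IsMultiAffine`).

## Source (verbatim) — P. Brändén, J. Huh, *Lorentzian polynomials* [BrandenHuh2019] (held `paper:arxiv-1902.03719`)

§3.2 Thm. 3.10: "The following are equivalent for any nonempty `J ⊆ ℕ^n`. (1) There is a Lorentzian polynomial whose
support is `J`. […] When `J ⊆ {0,1}^n`, any one of the above conditions is equivalent to (8) `J` is the set of bases of a
matroid on `[n]`." §2.4, after Thm. 2.23: "Since a multi-affine polynomial is stable if and only if it is strongly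
Rayleigh [Brändén], Theorem 2.23 extends the following theorem of Choe et al. [COSW]: If `f` is a nonzero homogeneous
stable multi-affine polynomial, then the support of `f` is the set of bases of a matroid."

## What is here

* **`exists_basesExp_eq_support_of_mem_lorentzian`**: the support of a nonzero multi-affine `f ∈ L^d_σ` is
  `{e_B : B a base of M}` for some Mathlib matroid `M` on `σ` (Thm. 3.10 (1) ⟹ (8) applied to `J = supp f`), every base
  having `d` elements (`ncard_eq_of_isBase_of_basesExp_eq_support`);
* **`exists_basesExp_eq_support_of_isRealStable`**: the Choe–Oxley–Sokal–Wagner theorem for quadratic forms with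
  nonnegative coefficients — the support of a real stable multi-affine quadratic form is the set of bases of a (rank `2`)
  matroid — through `mem_lorentzian_two_of_isRealStable`.

Theorems only (no definition, no named fact; net debt 0). -- TODO(general form): COSW in every degree needs "stable ⟹
Lorentzian" (Prop. 2.2) beyond degree `2`, not in the tree.

## References

* [BrandenHuh2019] P. Brändén, J. Huh, *Lorentzian polynomials*, Ann. of Math. (2) 192 (2020) 821–891, arXiv:1902.03719 —
  §3.2 Thm. 3.10; §2.4 (after Thm. 2.23, citing [COSW] = Choe–Oxley–Sokal–Wagner, Adv. Appl. Math. 32 (2004)).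
-/

noncomputable section

open MvPolynomial Finsupp Finset
open Literature.Combinatorics.StablePolynomials

namespace Literature.Combinatorics.LorentzianPolynomials

variable {σ : Type*} [Fintype σ] [DecidableEq σ]

/-! ## §1 Multi-affine Lorentzian polynomials are supported on matroids (Thm. 3.10 (1) ⟹ (8)) -/

section Lorentzian

omit [Fintype σ] [DecidableEq σ] in
/-- The support of a polynomial, as a set of exponents, is its Mathlib `support`.
[cite: BrandenHuh2019, §2.1 (p. 8, "the support of `f`")] -/
theorem coe_support_eq_setOf (f : MvPolynomial σ ℝ) :
    (f.support : Set (σ →₀ ℕ)) = {β : σ →₀ ℕ | coeff β f ≠ 0} := by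
  ext β
  rw [Finset.mem_coe, MvPolynomial.mem_support_iff, Set.mem_setOf_eq]

/-- **Brändén–Huh Thm. 3.10, (1) ⟹ (8), for the support of a given polynomial**: if `f ∈ L^d_σ` is nonzero and
multi-affine (all exponents in `{0,1}^σ`), then its support is the set `{e_B}` of (indicator vectors of) the bases of a
matroid on `σ`. [cite: BrandenHuh2019, §3.2 Thm. 3.10 ((1) ⟹ (8))] -/
theorem exists_basesExp_eq_support_of_mem_lorentzian {f : MvPolynomial σ ℝ} {d : ℕ} (hf : f ∈ lorentzian σ d)
    (h01 : IsMultiAffine f) (hf0 : f ≠ 0) :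
    ∃ M : Matroid σ, (basesExp M : Set (σ →₀ ℕ)) = {β : σ →₀ ℕ | coeff β f ≠ 0} := by
  have hJ01 : ∀ α ∈ f.support, ∀ i, α i ≤ 1 := (isMultiAffine_iff_support f).1 h01
  have hJd : ∀ α ∈ f.support, α.degree = d := fun α hα ↦ by
    by_contra hne
    exact (MvPolynomial.mem_support_iff.1 hα) ((isHomogeneous_of_mem_lorentzian hf).coeff_eq_zero hne)
  have hne : f.support.Nonempty := by
    rw [Finset.nonempty_iff_ne_empty, Ne, MvPolynomial.support_eq_empty]
    exact hf0
  obtain ⟨M, hM⟩ := (exists_support_eq_iff_exists_basesExp_eq hJ01 hJd hne).1 ⟨f, hf, (coe_support_eq_setOf f).symm⟩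
  exact ⟨M, by rw [hM, coe_support_eq_setOf]⟩

/-- In that situation every base of the matroid has `d` elements (the degree of `f`).
[cite: BrandenHuh2019, §3.2 Thm. 3.10; §2.2 (p. 11)] -/
theorem ncard_eq_of_isBase_of_basesExp_eq_support {f : MvPolynomial σ ℝ} {d : ℕ} (hf : f ∈ lorentzian σ d)
    {M : Matroid σ} (hM : (basesExp M : Set (σ →₀ ℕ)) = {β : σ →₀ ℕ | coeff β f ≠ 0}) {B : Set σ} (hB : M.IsBase B) :
    B.ncard = d := by
  have hmem : indSet B ∈ (basesExp M : Set (σ →₀ ℕ)) := Finset.mem_coe.2 (indSet_mem_basesExp.2 hB)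
  rw [hM, Set.mem_setOf_eq] at hmem
  rw [← degree_indSet B]
  by_contra hne
  exact hmem ((isHomogeneous_of_mem_lorentzian hf).coeff_eq_zero hne)

/-- Conversely (Thm. 3.10 (8) ⟹ (1) for supports): the set of bases of any matroid on `σ` is the support of a Lorentzian
polynomial, namely its basis generating polynomial. [cite: BrandenHuh2019, §3.2 Thm. 3.10 ((8) ⟹ (1))] -/
theorem basesExp_eq_support_basisGenPoly (M : Matroid σ) :
    (basesExp M : Set (σ →₀ ℕ)) = {β : σ →₀ ℕ | coeff β (basisGenPoly M) ≠ 0} :=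
  (support_basisGenPoly M).symm

end Lorentzian

/-! ## §2 Choe–Oxley–Sokal–Wagner for stable quadratic forms -/

section Stable

omit [Fintype σ] [DecidableEq σ] in
/-- A real stable polynomial is nonzero (it does not vanish at `(i, …, i) ∈ ℋ^n`).
[cite: BrandenHuh2019, §2.1 (p. 8, "non-vanishing on `ℋ^n` or identically zero")] -/
theorem ne_zero_of_isRealStable {p : MvPolynomial σ ℝ} (hp : IsRealStable p) : p ≠ 0 := by
  rintro rfl
  exact (isRealStable_iff 0).1 hp (fun _ ↦ Complex.I) (fun _ ↦ by simp) (by simp)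

/-- **Choe–Oxley–Sokal–Wagner in degree two** (as quoted by Brändén–Huh: "If `f` is a nonzero homogeneous stable
multi-affine polynomial, then the support of `f` is the set of bases of a matroid"), here for a real stable multi-affine
quadratic form with nonnegative coefficients: its support is `{e_B : B a base of M}` for a matroid `M` on `σ` whose bases
have two elements. [cite: BrandenHuh2019, §2.4 (after Thm. 2.23, [COSW]); §2.1 Lemma 2.5; §3.2 Thm. 3.10] -/
theorem exists_basesExp_eq_support_of_isRealStable {q : MvPolynomial σ ℝ} (hq : q.IsHomogeneous 2)
    (hnn : ∀ α, 0 ≤ coeff α q) (h01 : IsMultiAffine q) (hst : IsRealStable q) :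
    ∃ M : Matroid σ, (basesExp M : Set (σ →₀ ℕ)) = {β : σ →₀ ℕ | coeff β q ≠ 0} ∧ ∀ B, M.IsBase B → B.ncard = 2 := by
  have hL := mem_lorentzian_two_of_isRealStable hq hnn hst
  obtain ⟨M, hM⟩ := exists_basesExp_eq_support_of_mem_lorentzian hL h01 (ne_zero_of_isRealStable hst)
  exact ⟨M, hM, fun B hB ↦ ncard_eq_of_isBase_of_basesExp_eq_support hL hM hB⟩

/-- The same for a Lorentzian (equivalently: stable or zero) multi-affine quadratic form `q ≠ 0`.
[cite: BrandenHuh2019, §2.4 (after Thm. 2.23, [COSW]); §3.2 Thm. 3.10] -/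
theorem exists_basesExp_eq_support_of_mem_lorentzian_two {q : MvPolynomial σ ℝ} (hf : q ∈ lorentzian σ 2)
    (h01 : IsMultiAffine q) (hq0 : q ≠ 0) :
    ∃ M : Matroid σ, (basesExp M : Set (σ →₀ ℕ)) = {β : σ →₀ ℕ | coeff β q ≠ 0} ∧ ∀ B, M.IsBase B → B.ncard = 2 := by
  obtain ⟨M, hM⟩ := exists_basesExp_eq_support_of_mem_lorentzian hf h01 hq0
  exact ⟨M, hM, fun B hB ↦ ncard_eq_of_isBase_of_basesExp_eq_support hf hM hB⟩

end Stable

end Literature.Combinatorics.LorentzianPolynomials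

end
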